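import Literature.Barriers.QuantumAdvantage.PSimFPDecide
import Literature.Barriers.QuantumAdvantage.PBlockedSimInvariant
import HarnessLib

/-!
# Discharge of `jozsaLinden2003_pblocked` (Jozsa–Linden 2003, §3, theorem `pblthm`)

Topic `Literature/Barriers/QuantumAdvantage`; final file of the proof programme for the named fact
`Literature.Barriers.QuantumAdvantage.jozsaLinden2003_pblocked` (`BoundedEntanglement.lean`): a language
decided with bounded error by a polynomial-time uniform, oracle-free Clifford+`T` family all of whose
intermediate states are `p`-blocked lies in `BPP`. The two halves of the printed proof of lemma
`ratpbl` / theorem `pblthm` are in the tree: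

* the **machine half** — the classical simulator `PSim.simDecide` (`PBlockedSim.lean`) runs in
  polynomial time on the description of the `|z|`-th circuit: `PSimFPBits/Tables/Run/Decide.lean`
  (typed `FP` algebra `CodeFP`) with the size bound of `PBlockedSimSizeBound.lean` and the description
  plumbing of `PBlockedSimDescription.lean`, packaged as `jozsaLinden2003_pblocked_of_simDecide_eq`;
* the **specification half** — on an oracle-free family with `p`-blocked states and a width
  `W ≥ h + 2` the simulator's bit is the exact decision bit `pDecision F z` of
  `BoundedEntanglementReadout.lean`: `simDecide_eq_pDecision` (`PBlockedSimInvariant.lean`, over the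
  quantum half `BoundedEntanglement{Splitting,Locality,Configs,Blocks,Gram,Integral,GramZUpdate,
  ConjugateBound,Readout}.lean` and `PBlockedSimIdealTables.lean`).

This file identifies the two gate-list views (`gate3OfRaw ∘ rawOf = gateT` on oracle-free gates) and
concludes **`jozsaLinden2003_pblocked_holds`**.

## References

* R. Jozsa, N. Linden, *On the role of entanglement in quantum-computational speed-up*, Proc. R. Soc.
  Lond. A 459 (2003) 2011–2032, arXiv:quant-ph/0201143: §3 (theorem `pblthm`, lemma `ratpbl` and its
  proof), §2 (a finite-tolerance simulation of a bounded-error decision algorithm gives a `BPP`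
  algorithm).
-/

noncomputable section

namespace Literature.Barriers.QuantumAdvantage

namespace PSim

open Literature.Computability.Cryptography

variable {N : ℕ}

/-- The two gate-triple views agree on placed gates: the view read off the description
(`gate3OfRaw ∘ rawOf`, `PBlockedSimDescription.lean`) is the view of the specification (`gateT`,
`PBlockedSimInvariant.lean`). [folklore] -/
theorem gate3OfRaw_rawOf_gate (op : CliffordTOp) (e : Fin (cliffordT.arity op) ↪ Fin N) :
    gate3OfRaw (rawOf (QGate.gate op e : QGate cliffordT N)) = gateT (QGate.gate op e) := by
  cases op <;> rfl

/-- On an oracle-free family the gate views of the description are the gate views of the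
specification. [folklore] -/
theorem map_gate3OfRaw_rawOf_eq_map_gateT (F : QCircuitFamily cliffordT) (hF : F.IsOracleFree) (n : ℕ) :
    ((F.circ n).gates.map rawOf).map gate3OfRaw = (F.circ n).gates.map gateT := by
  rw [List.map_map]
  refine List.map_congr_left fun g hg => ?_
  obtain ⟨op, e, rfl⟩ := exists_eq_gate_of_isOracleFree (hF n g hg)
  exact gate3OfRaw_rawOf_gate op e

end PSim

open PSim Literature.Computability.Cryptography in
/-- **Jozsa–Linden 2003, §3, theorem `pblthm` (discharge of the named fact `jozsaLinden2003_pblocked`).**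
A language decided with error `≤ 1/3` by a polynomial-time uniform, polynomial-size, oracle-free
Clifford+`T` family all of whose intermediate states are `p`-blocked lies in `BPP`: the classical
machine of lemma `ratpbl` (`PSim.simDecide`, polynomial time by `simDecide_descFn_mem_FP`) computes,
on the description of the `|z|`-th circuit with the width `|F.descFn z| + 2 ≥ h + 2`
(`hExp_add_two_le_width`), exactly the decision bit `pDecision F z` (`simDecide_eq_pDecision`), whence
`L ∈ P ⊆ BPP` (`jozsaLinden2003_pblocked_of_decisionInFP`).
[cite: JozsaLinden2003, §3 (theorem pblthm, lemma ratpbl) with §2] -/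
theorem jozsaLinden2003_pblocked_holds : jozsaLinden2003_pblocked :=
  jozsaLinden2003_pblocked_of_simDecide_eq fun p F hF _ hP z => by
    rw [map_gate3OfRaw_rawOf_eq_map_gateT F hF]
    exact simDecide_eq_pDecision F z hF hP (hExp_add_two_le_width F z _)

end Literature.Barriers.QuantumAdvantage

end
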